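import Summits.ABC.StewartYu.PadicG3TwoFrameNumericsSharp
import Summits.ABC.StewartYu.PadicG3Par
import HarnessLib

/-!
# Cell abc-stewartyu, Gen-3 frame at `p = 2` (crux `Y07Two`, stmt-ABC-19659), record interface: the `p = 2`
# SCHEDULE `σ₂` instantiated from the parameter ledger `PadicG3Par`, and every STRUCTURAL obligation discharged —
# the frame numerics reduced to the budget lines

`Summits/ABC/StewartYu/PadicG3TwoSchedule.lean` — cell `abc-stewartyu` (HOME `run/shared/lean/pub/abc-stewartyu/`),
route `PadicPrimesKummerThird`, seat p5 (g3); on p5's `PadicG3TwoFrameNumericsSharp` and p1's `PadicG3Par`.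
Definitions (the triadic level schedule `T3`/`Xs3`/`Istar3`, the box, the weight/size slots, `schedTwo`) and
theorems; no named fact.  Design page: HOME/p5/SCHEDULE-p2-v0.md.

THE `p = 2` COLUMN (K-M3.1 (V7): `q = 3`, `K₀ = 1`, `θ₀(2) = 2`, pre-scaled Fel'dman basis).  Level-independent
quantities are p1's closed forms of `P : PadicG3Par (d+1)` (instantiate `p := 2`, `K₀ := 1`, `θ₀ := 2`, `A := V`,
`Nq := 2^m`): `P.m`, `P.L`, `P.M`, `P.X`, `P.L₀`, `P.H`.  The LEVEL schedule is the triadic twin of Nesterenko's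
(4.3)–(4.5): decrement `T3 I = ⌊4L/3^I⌋`, base range `Xs3 I = ⌊4XL/(T3 I + 1)⌋`, `d + 2` k-steps per level (the
first from the coprime nodes `|x| ≤ 3·Xs3 I`, then `3^k·Xs3 I`), start order `⌊M/(n+2)³⌋ + 2(n+2)·T3 I + 1`, depth
`Istar3 = ⌈log₃ 2^{n+24+m}⌉`, box `⌊L/(2Aⱼ)⌋/3^I + 1`, denominators `ν(H)^t`, Hasse sizes at `3^{I*−I}x`, `2`-adic
weight bound `max_{ℓ ≤ L₀} ‖den(ℓ,H)⁻¹‖₂(4·2^m)^ℓ`, Siegel coefficient bound `⌈#box·Amax⌉` (`Amax` the exact finite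
maximum over the level-`0` equations).  **`frameNumericsTwoC_schedTwo`**: `FrameNumericsTwoC (schedTwo S P) P.H P.L₀`
from EXACTLY the budget lines (L1) binomial Siegel count, (L2) k-step, (L3) third-step, plus the depth fit
`8·3^{I*} ≤ 4L`.  Design page: HOME/p5/SCHEDULE-p2-v0.md.

WHAT THIS IS NOT: the budget lines themselves (record: p1/lp-1, HOME/p5/SCHEDULE-p2-v0.md §2–§3); no crux moves.

References: Yu. V. Nesterenko, LNM 1819 (2003), §4 (4.3)–(4.5); K. Yu, Acta Math. 211 (2013), §3.1, (5.13);
HOME/p1/K-M3-1-padic-ledger.md (V7).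
-/

noncomputable section

open Finset Polynomial
open Literature.NumberTheory.Transcendental
open Literature.NumberTheory.Transcendental (FeldmanDelta.den)
open Literature.NumberTheory.Transcendental.FeldmanDelta
open Literature.NumberTheory.Transcendental.CW77.Setup (Tau tauNorm)
open Literature.NumberTheory.Transcendental.PadicCW77 (condExp)

namespace Summit.ABC.StewartYu

namespace TwoSetup

open Summit.ABC.StewartYu.FeldmanBasis Summit.ABC.StewartYu.G3Boxes

variable (S : TwoSetup) (P : PadicG3Par (S.d + 1))

/-! ### The triadic level schedule -/

/-- **Depth** `I* = ⌈log₃ 2^{n+24+m}⌉` (`n = d + 1`): `3^{I*} ≥ 2^{n+24}·2^m`. [cite: Nesterenko2003, (3.24); shape only] -/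
def Istar3 : ℕ := Nat.clog 3 (2 ^ (S.d + 1 + 24 + P.m))

/-- **Decrement** `T3 I = ⌊4L/3^I⌋` (multiplicity spent per k-step at level `I`). [cite: Nesterenko2003, (4.3); shape only] -/
def T3 (I : ℕ) : ℕ := 4 * P.L / 3 ^ I

/-- **Base range** `Xs3 I = ⌊4XL/(T3 I + 1)⌋` (so that `Xs3 I · T3 I ≈ 4XL` at every level). [cite: Nesterenko2003, (4.3); shape only] -/
def Xs3 (I : ℕ) : ℕ := 4 * P.X * P.L / (S.T3 P I + 1)

/-- **Start order** of level `I`: `⌊M/(n+2)³⌋ + 2(n+2)·T3 I + 1`. [cite: Nesterenko2003, (4.5); shape only] -/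
def T03 (I : ℕ) : ℕ := P.M / (S.d + 1 + 2) ^ 3 + 2 * (S.d + 1 + 2) * S.T3 P I + 1

/-- **Range after `k` sub-steps** of level `I`: `3^k·Xs3 I` for `k ≥ 1`; at `k = 0` the level's input range
(`X` at level `0`, the coprime nodes `|x| ≤ 3·Xs3 I` after a third step). [cite: Yu2013, Lemma 5.2 (5.23); shape only] -/
def Nsub3 (I k : ℕ) : ℕ :=
  if k = 0 then (if I = 0 then P.X else 3 * S.Xs3 P I) else 3 ^ k * S.Xs3 P I

/-- The level-`0` input range is `X`. [folklore] -/
@[simp] theorem Nsub3_zero_zero : S.Nsub3 P 0 0 = P.X := by simp [Nsub3]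

/-! ### Box, weights and sizes -/

/-- **Exponent box** at level `I`: `⌊L/(2Aⱼ)⌋/3^I + 1` (free generators). [cite: Nesterenko2003, (3.22); shape only] -/
def Dbox3 (I : ℕ) (j : Fin S.d) : ℕ := ⌊(P.L : ℝ) / (2 * P.A (Fin.castSucc j))⌋₊ / 3 ^ I + 1

/-- **Exponent box** at level `I` in `θ`: `⌊L/(2A_θ)⌋/3^I + 1`. [cite: Nesterenko2003, (3.22); shape only] -/
def Dθ3 (I : ℕ) : ℕ := ⌊(P.L : ℝ) / (2 * P.A (Fin.last S.d))⌋₊ / 3 ^ I + 1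

/-- **Directional bound** at level `I`: `1 + |b_θ|·∑ⱼ Dbox3 I j + (∑ⱼ |bⱼ|)·Dθ3 I`. [folklore] -/
def Xb3 (I : ℕ) : ℤ := 1 + |S.bθ| * ∑ j, (S.Dbox3 P I j : ℤ) + (∑ j, |S.b j|) * (S.Dθ3 P I : ℤ)

/-- **`2`-adic weight bound** `max_{ℓ ≤ L₀} ‖den(ℓ,H)⁻¹‖₂·(4·2^m)^ℓ`. [cite: Nesterenko2003, §3.1; shape only] -/
def Bw3 : ℝ := (Finset.range (P.L₀ + 1)).sup' ⟨0, by simp⟩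
  fun ℓ => ‖((den ℓ P.H : ℚ_[2]))⁻¹‖ * (4 * (2 : ℝ) ^ P.m) ^ ℓ

/-- **Hasse size** at level `I`, point `x`, multi-index `τ`:
`⌈3^{(I*−I)t}·ν(H)^t·e^{H/e}·(e(1+3^{I*−I}|x|/H))^{L₀}⌉`. [cite: Nesterenko2003, §3.1 Prop 3.1; shape only] -/
def M₀3 (I : ℕ) (x : ℤ) (τ : Tau S.d) : ℤ :=
  ⌈(3 : ℝ) ^ ((S.Istar3 P - I) * τ.1) * ((Nat.lcmUpto P.H : ℝ) ^ τ.1 *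
    (Real.exp (P.H / Real.exp 1) *
      (Real.exp 1 * (1 + (3 : ℝ) ^ (S.Istar3 P - I) * |(x : ℝ)| / P.H)) ^ P.L₀))⌉

/-- The uniform Hasse size on the level-`0` equations. [folklore] -/
def M₀E3 (hT : 1 ≤ S.T03 P 0) : ℤ :=
  (eqSet S.d P.X (S.T03 P 0)).sup' (eqSet_nonempty S.d P.X hT) fun e => S.M₀3 P 0 e.1 e.2

/-- The level-`0` Siegel coefficient size `Amax` (exact finite maximum, `≥ 1`). [cite: Yu2013, (4.28); shape only] -/
def Amax3 (hT : 1 ≤ S.T03 P 0) : ℝ :=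
  max 1 ((eqSet S.d P.X (S.T03 P 0)).sup' (eqSet_nonempty S.d P.X hT) fun e =>
    (S.M₀E3 P hT : ℝ) * (S.Xb3 P 0 : ℝ) ^ (∑ j, e.2.2 j) *
      ((MonomialDen.monDen S.toQ.all (S.boxExp (S.Dbox3 P 0) (S.Dθ3 P 0) e.1) : ℝ)) ^ 2)

/-- `1 ≤ T03 I`. [folklore] -/
theorem one_le_T03 (I : ℕ) : 1 ≤ S.T03 P I := by unfold T03; exact Nat.le_add_left 1 _

/-! ### The schedule -/

/-- **THE `p = 2` SCHEDULE `σ₂`** of the level induction, instantiated from `P : PadicG3Par (d+1)`.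
[cite: Nesterenko2003, §4 (4.3)–(4.5); shape only] -/
def schedTwo : S.G3TwoSched where
  Istar := S.Istar3 P
  m := P.m
  D₀ := P.L₀
  P := ⌈((famBox P.L₀ (S.Dbox3 P 0) (S.Dθ3 P 0)).card : ℝ) * S.Amax3 P (S.one_le_T03 P 0)⌉
  cardB := fun _ => (famBox P.L₀ (S.Dbox3 P 0) (S.Dθ3 P 0)).card
  Dbox := S.Dbox3 P
  Dθ := S.Dθ3 P
  Xb := S.Xb3 P
  Bw := fun _ => S.Bw3 P
  den₀ := fun _ _ τ => Nat.lcmUpto P.H ^ τ.1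
  M₀ := S.M₀3 P
  N0 := fun I => S.Nsub3 P I 0
  T0 := S.T03 P
  Nfin := fun I => 3 ^ (S.d + 2) * S.Xs3 P I
  Tfin := fun I => S.T03 P I - (S.d + 2) * S.T3 P I
  kst := fun _ => S.d + 2
  tdec := S.T3 P
  Nsub := S.Nsub3 P

/-! ### Structural facts -/

/-- `Dbox3 (I+1) = (Dbox3 I + 2)/3` (so `Dbox_succ` holds with equality). [folklore] -/
theorem Dbox3_succ (I : ℕ) (j : Fin S.d) : (S.Dbox3 P I j + 2) / 3 = S.Dbox3 P (I + 1) j := by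
  unfold Dbox3
  rw [pow_succ, ← Nat.div_div_eq_div_mul]
  omega

/-- `Dθ3 (I+1) = (Dθ3 I + 2)/3`. [folklore] -/
theorem Dθ3_succ (I : ℕ) : (S.Dθ3 P I + 2) / 3 = S.Dθ3 P (I + 1) := by
  unfold Dθ3
  rw [pow_succ, ← Nat.div_div_eq_div_mul]
  omega

/-- `T3 (I+1) ≤ T3 I / 3` (floor division). [folklore] -/
theorem T3_succ_le (I : ℕ) : S.T3 P (I + 1) ≤ S.T3 P I / 3 := by
  unfold T3
  rw [pow_succ, ← Nat.div_div_eq_div_mul]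

/-- The directional bound dominates `|b_θ|·Dbox3 I j + |bⱼ|·Dθ3 I`. [folklore] -/
theorem Xb3_ge (I : ℕ) (j : Fin S.d) :
    |S.bθ| * (S.Dbox3 P I j : ℤ) + |S.b j| * (S.Dθ3 P I : ℤ) ≤ S.Xb3 P I := by
  unfold Xb3
  have h1 : (S.Dbox3 P I j : ℤ) ≤ ∑ j', (S.Dbox3 P I j' : ℤ) :=
    Finset.single_le_sum (f := fun j' => (S.Dbox3 P I j' : ℤ)) (fun _ _ => by positivity) (Finset.mem_univ j)
  have h2 : |S.b j| ≤ ∑ j', |S.b j'| :=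
    Finset.single_le_sum (f := fun j' => |S.b j'|) (fun _ _ => abs_nonneg _) (Finset.mem_univ j)
  have h3 : (0 : ℤ) ≤ S.Dθ3 P I := by positivity
  nlinarith [abs_nonneg S.bθ, mul_le_mul_of_nonneg_left h1 (abs_nonneg S.bθ),
    mul_le_mul_of_nonneg_right h2 h3]

/-- `1 ≤ Xb3 I`. [folklore] -/
theorem one_le_Xb3 (I : ℕ) : 1 ≤ S.Xb3 P I := by
  unfold Xb3
  have h1 : (0 : ℤ) ≤ |S.bθ| * ∑ j, (S.Dbox3 P I j : ℤ) :=
    mul_nonneg (abs_nonneg _) (Finset.sum_nonneg fun _ _ => by positivity)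
  have h2 : (0 : ℤ) ≤ (∑ j, |S.b j|) * (S.Dθ3 P I : ℤ) :=
    mul_nonneg (Finset.sum_nonneg fun _ _ => abs_nonneg _) (by positivity)
  linarith

/-- `0 ≤ Xb3 I`. [folklore] -/
theorem Xb3_nonneg (I : ℕ) : 0 ≤ S.Xb3 P I := le_trans zero_le_one (S.one_le_Xb3 P I)

/-- The `2`-adic weight line at every `ℓ ≤ L₀`. [folklore] -/
theorem Bw3_ge (ℓ : ℕ) (hℓ : ℓ ≤ P.L₀) :
    ‖((den ℓ P.H : ℚ_[2]))⁻¹‖ * (4 * (2 : ℝ) ^ P.m) ^ ℓ ≤ S.Bw3 P := by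
  unfold Bw3
  exact Finset.le_sup' (fun ℓ => ‖((den ℓ P.H : ℚ_[2]))⁻¹‖ * (4 * (2 : ℝ) ^ P.m) ^ ℓ)
    (Finset.mem_range.mpr (by omega))

/-- The Hasse-size line at every `ℓ ≤ L₀` (`(e(1+y/H))^ℓ` is monotone in `ℓ`). [folklore] -/
theorem M₀3_ge (I : ℕ) (x : ℤ) (τ : Tau S.d) (ℓ : ℕ) (hℓ : ℓ ≤ P.L₀) :
    (3 : ℝ) ^ ((S.Istar3 P - I) * τ.1) * ((Nat.lcmUpto P.H : ℝ) ^ τ.1 *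
      (Real.exp (P.H / Real.exp 1) *
        (Real.exp 1 * (1 + (3 : ℝ) ^ (S.Istar3 P - I) * |(x : ℝ)| / P.H)) ^ ℓ)) ≤ S.M₀3 P I x τ := by
  unfold M₀3
  refine le_trans ?_ (Int.le_ceil _)
  have hbase : (1 : ℝ) ≤ Real.exp 1 * (1 + (3 : ℝ) ^ (S.Istar3 P - I) * |(x : ℝ)| / P.H) := by
    have h1 : (1 : ℝ) ≤ Real.exp 1 := Real.one_le_exp zero_le_one
    have h2 : (0 : ℝ) ≤ (3 : ℝ) ^ (S.Istar3 P - I) * |(x : ℝ)| / P.H := by positivity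
    nlinarith
  gcongr

/-- The uniform Hasse size dominates on the level-`0` equations. [folklore] -/
theorem M₀3_le_M₀E3 (hT : 1 ≤ S.T03 P 0) {e : ℤ × Tau S.d} (he : e ∈ eqSet S.d P.X (S.T03 P 0)) :
    S.M₀3 P 0 e.1 e.2 ≤ S.M₀E3 P hT := by
  unfold M₀E3
  exact Finset.le_sup' (fun e : ℤ × Tau S.d => S.M₀3 P 0 e.1 e.2) he

/-- The Siegel coefficient size dominates on the level-`0` equations. [folklore] -/
theorem prod_le_Amax3 (hT : 1 ≤ S.T03 P 0) {e : ℤ × Tau S.d} (he : e ∈ eqSet S.d P.X (S.T03 P 0)) :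
    (S.M₀E3 P hT : ℝ) * (S.Xb3 P 0 : ℝ) ^ (∑ j, e.2.2 j) *
      ((MonomialDen.monDen S.toQ.all (S.boxExp (S.Dbox3 P 0) (S.Dθ3 P 0) e.1) : ℝ)) ^ 2 ≤ S.Amax3 P hT := by
  unfold Amax3
  refine le_trans ?_ (le_max_right _ _)
  exact Finset.le_sup' (fun e : ℤ × Tau S.d => (S.M₀E3 P hT : ℝ) * (S.Xb3 P 0 : ℝ) ^ (∑ j, e.2.2 j) *
    ((MonomialDen.monDen S.toQ.all (S.boxExp (S.Dbox3 P 0) (S.Dθ3 P 0) e.1) : ℝ)) ^ 2) he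

/-- `KTwo` of the schedule is positive. [folklore] -/
theorem KTwo_schedTwo_pos (I : ℕ) (x : ℤ) (τ : Tau S.d) : 0 < KTwo (S.schedTwo P) I x τ := by
  unfold KTwo
  have hcard : (0 : ℝ) < ((S.schedTwo P).cardB I : ℝ) := by
    change (0 : ℝ) < (((famBox P.L₀ (S.Dbox3 P 0) (S.Dθ3 P 0)).card : ℕ) : ℝ)
    rw [card_famBox]; positivity
  have hA1 : (1 : ℝ) ≤ S.Amax3 P (S.one_le_T03 P 0) := le_max_left _ _
  have hP : (0 : ℝ) < ((S.schedTwo P).P : ℝ) := by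
    change (0 : ℝ) < ((⌈((famBox P.L₀ (S.Dbox3 P 0) (S.Dθ3 P 0)).card : ℝ) *
      S.Amax3 P (S.one_le_T03 P 0)⌉ : ℤ) : ℝ)
    have hc : (1 : ℝ) ≤ ((famBox P.L₀ (S.Dbox3 P 0) (S.Dθ3 P 0)).card : ℝ) := by
      rw [card_famBox]; exact_mod_cast Nat.one_le_iff_ne_zero.mpr (by positivity)
    have : (1 : ℝ) ≤ ((famBox P.L₀ (S.Dbox3 P 0) (S.Dθ3 P 0)).card : ℝ) *
        S.Amax3 P (S.one_le_T03 P 0) := one_le_mul_of_one_le_of_one_le hc hA1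
    have h1 : (1 : ℤ) ≤ ⌈((famBox P.L₀ (S.Dbox3 P 0) (S.Dθ3 P 0)).card : ℝ) *
        S.Amax3 P (S.one_le_T03 P 0)⌉ := Int.one_le_ceil_iff.mpr (by linarith)
    exact_mod_cast h1
  have hM : (0 : ℝ) < ((S.schedTwo P).M₀ I x τ : ℝ) := by
    change (0 : ℝ) < ((S.M₀3 P I x τ : ℤ) : ℝ)
    have h := S.M₀3_ge P I x τ 0 (Nat.zero_le _)
    rw [pow_zero, mul_one] at h
    have hpos : (0 : ℝ) < (3 : ℝ) ^ ((S.Istar3 P - I) * τ.1) * ((Nat.lcmUpto P.H : ℝ) ^ τ.1 *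
        Real.exp (P.H / Real.exp 1)) := by
      have : (0 : ℝ) < (Nat.lcmUpto P.H : ℝ) := by exact_mod_cast Nat.lcmUpto_pos P.H
      positivity
    exact hpos.trans_le h
  have hXb : (0 : ℝ) < ((S.schedTwo P).Xb I : ℝ) ^ (∑ j, τ.2 j) := by
    change (0 : ℝ) < ((S.Xb3 P I : ℤ) : ℝ) ^ (∑ j, τ.2 j)
    refine pow_pos ?_ _
    have h1 := S.one_le_Xb3 P I
    exact_mod_cast (show (0 : ℤ) < S.Xb3 P I by omega)
  have hmon : (0 : ℝ) < ((MonomialDen.monDen S.toQ.all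
      (S.boxExp ((S.schedTwo P).Dbox I) ((S.schedTwo P).Dθ I) x) : ℝ)) ^ 2 := by
    have : 1 ≤ MonomialDen.monDen S.toQ.all (S.boxExp ((S.schedTwo P).Dbox I) ((S.schedTwo P).Dθ I) x) :=
      MonomialDen.one_le_monDen _ S.toQ.all_ne _
    positivity
  positivity

/-! ### Projections of the schedule (`rfl`) -/

/-- Projection of `schedTwo`. [folklore] -/
@[simp] theorem schedTwo_Istar : (S.schedTwo P).Istar = S.Istar3 P := rfl
/-- Projection of `schedTwo`. [folklore] -/
@[simp] theorem schedTwo_m : (S.schedTwo P).m = P.m := rfl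
/-- Projection of `schedTwo`. [folklore] -/
@[simp] theorem schedTwo_D₀ : (S.schedTwo P).D₀ = P.L₀ := rfl
/-- Projection of `schedTwo`. [folklore] -/
@[simp] theorem schedTwo_cardB (I : ℕ) :
    (S.schedTwo P).cardB I = (famBox P.L₀ (S.Dbox3 P 0) (S.Dθ3 P 0)).card := rfl
/-- Projection of `schedTwo`. [folklore] -/
@[simp] theorem schedTwo_Dbox : (S.schedTwo P).Dbox = S.Dbox3 P := rfl
/-- Projection of `schedTwo`. [folklore] -/
@[simp] theorem schedTwo_Dθ : (S.schedTwo P).Dθ = S.Dθ3 P := rfl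
/-- Projection of `schedTwo`. [folklore] -/
@[simp] theorem schedTwo_Xb : (S.schedTwo P).Xb = S.Xb3 P := rfl
/-- Projection of `schedTwo`. [folklore] -/
@[simp] theorem schedTwo_Bw (I : ℕ) : (S.schedTwo P).Bw I = S.Bw3 P := rfl
/-- Projection of `schedTwo`. [folklore] -/
@[simp] theorem schedTwo_den₀ (I : ℕ) (x : ℤ) (τ : Tau S.d) :
    (S.schedTwo P).den₀ I x τ = Nat.lcmUpto P.H ^ τ.1 := rfl
/-- Projection of `schedTwo`. [folklore] -/
@[simp] theorem schedTwo_M₀ : (S.schedTwo P).M₀ = S.M₀3 P := rfl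
/-- Projection of `schedTwo`. [folklore] -/
@[simp] theorem schedTwo_N0 (I : ℕ) : (S.schedTwo P).N0 I = S.Nsub3 P I 0 := rfl
/-- Projection of `schedTwo`. [folklore] -/
@[simp] theorem schedTwo_T0 : (S.schedTwo P).T0 = S.T03 P := rfl
/-- Projection of `schedTwo`. [folklore] -/
@[simp] theorem schedTwo_Nfin (I : ℕ) : (S.schedTwo P).Nfin I = 3 ^ (S.d + 2) * S.Xs3 P I := rfl
/-- Projection of `schedTwo`. [folklore] -/
@[simp] theorem schedTwo_Tfin (I : ℕ) : (S.schedTwo P).Tfin I = S.T03 P I - (S.d + 2) * S.T3 P I := rfl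
/-- Projection of `schedTwo`. [folklore] -/
@[simp] theorem schedTwo_kst (I : ℕ) : (S.schedTwo P).kst I = S.d + 2 := rfl
/-- Projection of `schedTwo`. [folklore] -/
@[simp] theorem schedTwo_tdec : (S.schedTwo P).tdec = S.T3 P := rfl
/-- Projection of `schedTwo`. [folklore] -/
@[simp] theorem schedTwo_Nsub : (S.schedTwo P).Nsub = S.Nsub3 P := rfl
/-- Projection of `schedTwo`. [folklore] -/
@[simp] theorem schedTwo_P : (S.schedTwo P).P =
    ⌈((famBox P.L₀ (S.Dbox3 P 0) (S.Dθ3 P 0)).card : ℝ) * S.Amax3 P (S.one_le_T03 P 0)⌉ := rfl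

end TwoSetup

end Summit.ABC.StewartYu

end
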